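import Literature.MathematicalPhysics.QuantumFieldTheory.Balaban1983to89.B9Ineq369CurvatureSmallAtLettersY

/-!
# `Balaban1983to89.B9Thm311PosOfPrincipalAtLettersY` — T. Bałaban, *Propagators for lattice gauge theories in a background field*, Commun. Math. Phys. **99**
# (1985) 389–434 [Balaban1985BackgroundPropagators] (3.69) p. 404 ∕ p. 392 with Thm 3.11 p. 416: «Δ′ IS A SMALL PERTURBATION OF D\*D» AS A FORM BOUND ON
# def-Y's HESSIAN `hessY i U`, and ROW 17's ONE DISPLAYED CLAUSE «Δ_a(U) positive definite» REDUCED to the coercivity of the principal gauge-fixed form of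
# (3.26) plus the plaquette smallness that (3.35) supplies (file 2∕2; file 1 = `B9Ineq369CurvatureSmallAtLettersY`: the two halves of `Δ′`)

statement-level skeleton of published theorems with citation tags; proofs where landed; nothing here is a claim about the Yang–Mills mass gap

PDF held: `paper:balaban1985-cmp99-background-propagators` (journal page = PDF page + 388); pp. 392, 396, 404, 416 read by this seat (2026-08-27).

THE PRINT (verbatim).  p. 404, (3.69): *«|(Δ′(U′U)A′)(b)| ≤ O(1)(Mα₀ + α₁)(Lʲη)⁻²|A′|, b ∈ Ω_j (3.69) the supremum on the right-hand side is taken over bonds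
belonging to one of the plaquettes containing the bond b […] the estimates follow directly from the assumptions (3.35), (3.37).»*  p. 416, Thm 3.11: *«Let us
assume that U satisfies (3.35). Then … the operators Δ′_a, G′, (Q′G′²Q′\*)⁻¹, Δ_a, G are positive definite.»*  p. 395, (3.26): *«Δ_a = Δ + DRD\* + Q\*aQ»*.

WHY THIS FILE (cell context).  File 1 bounded the two halves of `Δ′(U) = D\*_U(𝒦_U − 1)D_U + Δ′₂(U)` at def-Y's letters.  Here: the incidence count behind
«plaquettes containing the bond b», the two plaquette estimates «|Re U(∂p) − 1| ≤ …, |Im U(∂p)| ≤ …» from `|U(∂p) − 1| ≤ δ` at unitary holonomies, the assembled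
form bound on def-Y's `hessY` — local (position-dependent weights, as (3.69)'s `b ∈ Ω_j`) and uniform — and the REDUCTION of the N06 certificate's row-17 clause
`hΔA` (`PosDefTr 1 (deltaAY x.toKIdx (parSymY _) (parBY _) (GpY _ (parSymY _)) U)`, this seat's `B9Thm311PosAtRecordV4.t311_of_pins_opsYOfLettersV4₁`; ref-A g18
WATCH-ΔA) to two displayed inputs: (i) COERCIVITY OF THE PRINCIPAL GAUGE-FIXED FORM `(1−δ)⟨D_UA, D_UA⟩₁ + ⟨D\*_UA, R(U)D\*_UA⟩₁ + ⟨Q(U)A, Q(U)A⟩_w ≥ γ⟨A, A⟩₁`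
(the content of Thm 3.3 ∕ of [4] = [Balaban1984PropagatorsII] in the flat case — NOT proved here), (ii) `δ`-SMALL PLAQUETTE HOLONOMIES with `12(d+1)c_f²δ < γ`
(print: «follow directly from the assumptions (3.35)» — NOT proved here).  So the curvature part of what `hΔA` owes (this lineage's HOME/TRIGGERS.md list:
«flat coercivity · cube-wise small gauge · Lipschitz bounds of hessY in the background · IMS localisation») is DISCHARGED at the letters of record.
PRIOR ART DECLARED.  The pub-balaban NE9 chain's `B9Ineq369CurvatureSmall.sum_edge_le` ∕ `norm_inner_curvOp_self_le` ∕ `hpos_of_principal_coercive` are the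
same three steps at ITS letters (`curvOp` on `BondL2K`); no bridge to def-Y's `trLiftY` letters exists, so the steps are re-done here for `Node00.edgeY ∕ holY ∕
hessY ∕ deltaAY`; nothing of theirs is restated or imported.

WHAT IS PROVED (sorry-free; 0 `def`; no inequality of the paper asserted).
* §4 incidence: `edgeY_dir_ne_otherDir`, ★ `edgeCode_injective` (`(p, m) ↦ (b_m(p), m, other direction)` is injective), ★ `sum_edgeY_le`
  (`Σ_p Σ_{m<4} g(b_m(p)) ≤ 4(d+1)·Σ_b g(b)` for `g ≥ 0`).
* §5 plaquettes at a unitary-valued `U`: `norm_holY_inv_sub_one` (`|U(∂p)⁻¹ − 1| = |U(∂p) − 1|`), ★ `norm_reHolY_sub_one_le`, ★ `norm_imHolY_le`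
  (`|U(∂p) − 1| ≤ δ ⇒ |Re U(∂p) − 1| ≤ δ, |Im U(∂p)| ≤ δ`).
* §6 ★ `trIP_hessY_eq` ((3.10) as forms: `⟨A, Δ(U)A⟩₁ = ⟨D_UA, 𝒦_UD_UA⟩₁ + ⟨A, Δ′₂(U)A⟩₁`, by this lineage's `isAdjTr_curlY_coCurlY`), ★★★ **`trIP_hessY_ge`**
  (local form of (3.69): `⟨A, Δ(U)A⟩₁ ≥ Σ_p (1 − |Re U(∂p) − 1|)·HS((D_UA)(p)) − 3·Σ_p c_f²|Im U(∂p)|·Σ_{m<4} HS(A(b_m(p)))`), ★★★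
  **`trIP_hessY_ge_of_plaquette_small`** (uniform form: `0 ≤ δ`, all `|U(∂p) − 1| ≤ δ` ⇒ `⟨A, Δ(U)A⟩₁ ≥ (1 − δ)⟨D_UA, D_UA⟩₁ − 12(d+1)c_f²δ·⟨A, A⟩₁`), ★★★
  **`posDefTr_deltaAY_parSymY_of_principal`**: `G ≤ U(N)`, `U` `G`-valued, `0 ≤ δ`, all `|U(∂p) − 1| ≤ δ`, principal coercivity with `γ > 12(d+1)c_f²δ` ⇒
  `PosDefTr 1 (deltaAY i (parSymY i) (parBY i) (GpY i (parSymY i)) U)` (composes `B9Thm311ProjectionR.posDefTr_deltaAY_parSymY_of_forms`).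
MODEL ∕ DECLARED READINGS.  (M1) as file 1 (def-Y's letters at a k-level index `i`, fibre `M_N(ℂ)`, `trIP`, `L²`-operator norm, `c_f = i.cf`); the averaging weight
`i.w` on index bonds as in `B9Thm311ProjectionR.trIP_deltaAY_parSymY_eq`.  (M2) hypotheses DISPLAYED: `U` unitary-∕`G`-valued; `0 ≤ δ` and `|U(∂p) − 1| ≤ δ` for every
plaquette (print: from (3.35), `δ = O(1)Mα₀(Lʲη)⁻²η²` on `Ω_j`, so the scale-free product `c_f²δ ≤ O(1)Mα₀`); the principal coercivity `γ`.  (M3) the constants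
`4(d+1)` (injective code; the sharp count is `2d`) and `12(d+1) = 3·4(d+1)` are this file's witnesses for print's `O(1)`; the local form keeps (3.69)'s
position-dependent weights, the uniform form takes one `δ`.  (M4) NOT HERE: the sup-norm (pointwise) form of (3.69); `(3.35) ⇒ δ`; the coercivity (Thm 3.3 ∕ [4]);
an IMS ∕ random-walk localisation; `Δ′(U′U) − Δ′(U)`.
HONEST SCOPE.  An elementary perturbation bound + a reduction at the letters of record; `hΔA` is NOT discharged (reduced to (i) + (ii), both displayed); NOT a
node discharge, NOT summit progress; count-neutral; nothing continuum ∕ OS ∕ mass gap ∕ Clay.  Cell `pub-ymgap` (HUMAN RULING D-0062), Track A node N06 [B9],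
seat `pub-ymgap-dag-n06-j` (bundle F5 rows 15–17; harness re-seat gen 11), 2026-08-27; dag-lead g9 DEDUP GO (7).  NEW file importing file 1 only; nothing landed is
modified.  Net new unproved facts: 0.
-/

noncomputable section

namespace Literature.MathematicalPhysics.QuantumFieldTheory.Balaban1983to89.B9Thm311PosOfPrincipalAtLettersY

open Literature.MathematicalPhysics.QuantumFieldTheory.Balaban1983to89
open B9Thm311ReadingCoords B9Thm311AdjointAtLetters B9Thm311DeltaPrimeSymm B9Thm311DeltaPrimePos B9Thm311AdjointPairs B9Thm311Curv2Symm
  B9Thm311ProjectionR B9Ineq349SiteAdjoint B9Ineq369CurvatureSmallAtLettersY Node00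
open B6KLevelCensusIndexV1
open scoped Matrix

/-! ## §4 Incidence: every bond is an edge of at most `4(d+1)` (plaquette, position) pairs -/

section Incidence

variable {d ℓ : ℕ} {hd : 1 ≤ d + 1} {hL : Odd (ℓ + 1) ∧ 1 < ℓ + 1} {b₀ b₁ : ℝ}
variable (i : KIdx d ℓ hd hL b₀ b₁)

/-- translation by `e_μ` is injective on the fine torus. [folklore] -/
private theorem shift_inj {P : Params} {x y : Site P 0} {μ : Fin P.d} (h : x.shift μ = y.shift μ) : x = y := by
  funext ν
  have hν := congrFun h ν
  by_cases hνμ : ν = μ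
  · subst hνμ
    simpa [Site.shift] using hν
  · simpa [Site.shift, Function.update_of_ne hνμ] using hν

/-- the «other direction» of the plaquette seen from its `m`-th contour bond: `ν, μ, ν, μ` for `⟨z, w⟩, ⟨w, x⟩, ⟨x, y⟩, ⟨y, z⟩`.
[cite: Balaban1985BackgroundPropagators, (3.2) p.390, bookkeeping] -/
theorem edgeY_dir_ne_otherDir (p : PlaqY i) (m : Fin 4) : (edgeY i p m).dir ≠ (![p.ν, p.μ, p.ν, p.μ] : Fin 4 → Fin (d + 1)) m := by
  have h := p.hμν
  fin_cases m <;> simp [edgeY] <;> [exact h.ne; exact h.ne'; exact h.ne; exact h.ne']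

/-- ★ THE EDGE CODE `(p, m) ↦ (b_m(p), m, other direction)` IS INJECTIVE — a plaquette is recovered from one contour bond, its position and the
second direction. [cite: Balaban1985BackgroundPropagators, (3.2) p.390 (the contour ∂(p)_z), (3.69) p.404 («plaquettes containing the bond b»)] -/
theorem edgeCode_injective :
    Function.Injective fun pm : PlaqY i × Fin 4 => (edgeY i pm.1 pm.2, pm.2, (![pm.1.ν, pm.1.μ, pm.1.ν, pm.1.μ] : Fin 4 → Fin (d + 1)) pm.2) := by
  rintro ⟨p, m⟩ ⟨p', m'⟩ h
  simp only [Prod.mk.injEq] at h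
  obtain ⟨he, hm, ho⟩ := h
  subst hm
  obtain ⟨s, μ, ν, hμν⟩ := p
  obtain ⟨s', μ', ν', hμν'⟩ := p'
  fin_cases m <;> simp [edgeY, PBond.mk.injEq] at he ho
  · obtain ⟨hs, hμ⟩ := he
    subst hμ ho
    obtain rfl := shift_inj hs
    rfl
  · obtain ⟨hs, hν⟩ := he
    subst hs hν ho
    rfl
  · obtain ⟨hs, hμ⟩ := he
    subst hs hμ ho
    rfl
  · obtain ⟨hs, hν⟩ := he
    subst hν ho
    obtain rfl := shift_inj hs
    rfl

/-- ★ **INCIDENCE BOUND**: for `g ≥ 0` on bonds, `Σ_p Σ_{m<4} g(b_m(p)) ≤ 4(d+1)·Σ_b g(b)` — this file's witness for «the supremum … over bonds belonging to one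
of the plaquettes containing the bond b» (each bond lies on `2d ≤ 4(d+1)` contours). [cite: Balaban1985BackgroundPropagators, (3.69) p.404] -/
theorem sum_edgeY_le {g : FBondY i → ℝ} (hg : ∀ b, 0 ≤ g b) :
    ∑ p : PlaqY i, ∑ m : Fin 4, g (edgeY i p m) ≤ 4 * (d + 1) * ∑ b : FBondY i, g b := by
  classical
  have h1 : ∑ p : PlaqY i, ∑ m : Fin 4, g (edgeY i p m) = ∑ pm : PlaqY i × Fin 4, g (edgeY i pm.1 pm.2) :=
    (Fintype.sum_prod_type' fun p m => g (edgeY i p m)).symm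
  have h2 : ∑ pm : PlaqY i × Fin 4, g (edgeY i pm.1 pm.2) = ∑ y ∈ (Finset.univ : Finset (PlaqY i × Fin 4)).image
      (fun pm : PlaqY i × Fin 4 => (edgeY i pm.1 pm.2, pm.2, (![pm.1.ν, pm.1.μ, pm.1.ν, pm.1.μ] : Fin 4 → Fin (d + 1)) pm.2)), g y.1 :=
    (Finset.sum_image (f := fun y : FBondY i × Fin 4 × Fin (d + 1) => g y.1) fun x _ y _ hxy => edgeCode_injective i hxy).symm
  have h3 : ∑ y ∈ (Finset.univ : Finset (PlaqY i × Fin 4)).image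
      (fun pm : PlaqY i × Fin 4 => (edgeY i pm.1 pm.2, pm.2, (![pm.1.ν, pm.1.μ, pm.1.ν, pm.1.μ] : Fin 4 → Fin (d + 1)) pm.2)), g y.1
        ≤ ∑ y : FBondY i × Fin 4 × Fin (d + 1), g y.1 :=
    Finset.sum_le_sum_of_subset_of_nonneg (Finset.subset_univ _) fun y _ _ => hg y.1
  have h4 : ∑ y : FBondY i × Fin 4 × Fin (d + 1), g y.1 = 4 * (d + 1) * ∑ b : FBondY i, g b := by
    rw [Fintype.sum_prod_type, Finset.mul_sum]
    refine Finset.sum_congr rfl fun b _ => ?_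
    show ∑ _y : Fin 4 × Fin (d + 1), g b = _
    rw [Finset.sum_const, Finset.card_univ, Fintype.card_prod, Fintype.card_fin, Fintype.card_fin, nsmul_eq_mul]
    push_cast
    ring
  rw [h1, h2]
  exact h3.trans_eq h4

end Incidence

/-! ## §5 Plaquette smallness: `|U(∂p) − 1| ≤ δ` gives `|Re U(∂p) − 1| ≤ δ`, `|Im U(∂p)| ≤ δ` at unitary holonomies -/

section Plaquette

open scoped Matrix.Norms.L2Operator

variable {d ℓ : ℕ} {hd : 1 ≤ d + 1} {hL : Odd (ℓ + 1) ∧ 1 < ℓ + 1} {b₀ b₁ : ℝ} {N : ℕ}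
variable (i : KIdx d ℓ hd hL b₀ b₁) (U : CfgY (Matrix (Fin N) (Fin N) ℂ) i)

/-- at a unitary holonomy `|U(∂p)⁻¹ − 1| = |U(∂p) − 1|` (`V⁻¹ − 1 = (V − 1)\*`). [cite: Balaban1985BackgroundPropagators, (3.5) p.391 (U(−∂p) = U(∂p)⁻¹), bookkeeping] -/
theorem norm_holY_inv_sub_one (hU : ∀ μ x, ((U μ x : (Matrix (Fin N) (Fin N) ℂ)ˣ) : Matrix (Fin N) (Fin N) ℂ) ∈ unitary (Matrix (Fin N) (Fin N) ℂ))
    (p : PlaqY i) :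
    ‖(((holY i U p)⁻¹ : (Matrix (Fin N) (Fin N) ℂ)ˣ) : Matrix (Fin N) (Fin N) ℂ) - 1‖ = ‖((holY i U p : (Matrix (Fin N) (Fin N) ℂ)ˣ) : Matrix (Fin N) (Fin N) ℂ) - 1‖ := by
  have h1 : ((holY i U p : (Matrix (Fin N) (Fin N) ℂ)ˣ) : Matrix (Fin N) (Fin N) ℂ)ᴴ - 1 =
      (((holY i U p : (Matrix (Fin N) (Fin N) ℂ)ˣ) : Matrix (Fin N) (Fin N) ℂ) - 1)ᴴ := by
    rw [Matrix.conjTranspose_sub, Matrix.conjTranspose_one]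
  rw [val_inv_eq_conjTranspose _ (holY_mem_unitary i U hU p), h1, Matrix.l2_opNorm_conjTranspose]

/-- `|Re U(∂p) − 1| ≤ δ` when `|U(∂p) − 1| ≤ δ`. [cite: Balaban1985BackgroundPropagators, (3.69) p.404 («|Re U(∂p) − 1| ≤ …»)] -/
theorem norm_reHolY_sub_one_le (hU : ∀ μ x, ((U μ x : (Matrix (Fin N) (Fin N) ℂ)ˣ) : Matrix (Fin N) (Fin N) ℂ) ∈ unitary (Matrix (Fin N) (Fin N) ℂ))
    {p : PlaqY i} {δ : ℝ} (hp : ‖((holY i U p : (Matrix (Fin N) (Fin N) ℂ)ˣ) : Matrix (Fin N) (Fin N) ℂ) - 1‖ ≤ δ) : ‖reHolY i U p - 1‖ ≤ δ := by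
  have hre : reHolY i U p - 1 = (((1 / 2 : ℝ)) : ℂ) • ((((holY i U p : (Matrix (Fin N) (Fin N) ℂ)ˣ) : Matrix (Fin N) (Fin N) ℂ) - 1) +
      ((((holY i U p)⁻¹ : (Matrix (Fin N) (Fin N) ℂ)ˣ) : Matrix (Fin N) (Fin N) ℂ) - 1)) := by
    rw [reHolY, show ((1 / 2 : ℂ)) = (((1 / 2 : ℝ) : ℂ)) by push_cast; ring]
    module
  rw [hre]
  refine (norm_smul_le _ _).trans ?_
  rw [Complex.norm_real, Real.norm_eq_abs, abs_of_nonneg (by norm_num : (0 : ℝ) ≤ 1 / 2)]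
  have h2 := norm_add_le ((((holY i U p : (Matrix (Fin N) (Fin N) ℂ)ˣ) : Matrix (Fin N) (Fin N) ℂ) - 1))
    (((((holY i U p)⁻¹ : (Matrix (Fin N) (Fin N) ℂ)ˣ) : Matrix (Fin N) (Fin N) ℂ) - 1))
  rw [norm_holY_inv_sub_one i U hU p] at h2
  linarith

/-- `|Im U(∂p)| ≤ δ` when `|U(∂p) − 1| ≤ δ`. [cite: Balaban1985BackgroundPropagators, (3.69) p.404 («|Im U(∂p)| ≤ …»)] -/
theorem norm_imHolY_le (hU : ∀ μ x, ((U μ x : (Matrix (Fin N) (Fin N) ℂ)ˣ) : Matrix (Fin N) (Fin N) ℂ) ∈ unitary (Matrix (Fin N) (Fin N) ℂ))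
    {p : PlaqY i} {δ : ℝ} (hp : ‖((holY i U p : (Matrix (Fin N) (Fin N) ℂ)ˣ) : Matrix (Fin N) (Fin N) ℂ) - 1‖ ≤ δ) : ‖imHolY i U p‖ ≤ δ := by
  have him : imHolY i U p = (-Complex.I / 2) • ((((holY i U p : (Matrix (Fin N) (Fin N) ℂ)ˣ) : Matrix (Fin N) (Fin N) ℂ) - 1) -
      ((((holY i U p)⁻¹ : (Matrix (Fin N) (Fin N) ℂ)ˣ) : Matrix (Fin N) (Fin N) ℂ) - 1)) := by
    rw [imHolY, sub_sub_sub_cancel_right]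
  rw [him]
  refine (norm_smul_le _ _).trans ?_
  rw [norm_div, norm_neg, Complex.norm_I, Complex.norm_ofNat]
  have h2 := norm_sub_le ((((holY i U p : (Matrix (Fin N) (Fin N) ℂ)ˣ) : Matrix (Fin N) (Fin N) ℂ) - 1))
    (((((holY i U p)⁻¹ : (Matrix (Fin N) (Fin N) ℂ)ˣ) : Matrix (Fin N) (Fin N) ℂ) - 1))
  rw [norm_holY_inv_sub_one i U hU p] at h2
  linarith

end Plaquette

/-! ## §6 The Hessian: `⟨A, Δ(U)A⟩₁ ≥ Σ_p (1 − |Re U(∂p) − 1|)·HS((D_UA)(p)) − 3c_f²·Σ_p |Im U(∂p)|·Σ_m HS(A(b_m(p)))`, and row 17 reduced -/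

section Hessian

open scoped Matrix.Norms.L2Operator

variable {d ℓ : ℕ} {hd : 1 ≤ d + 1} {hL : Odd (ℓ + 1) ∧ 1 < ℓ + 1} {b₀ b₁ : ℝ} {N : ℕ}
variable (i : KIdx d ℓ hd hL b₀ b₁) {U : CfgY (Matrix (Fin N) (Fin N) ℂ) i}

/-- (3.10) as forms at the letters: `⟨A, Δ(U)A⟩₁ = ⟨D_UA, 𝒦_U D_UA⟩₁ + ⟨A, Δ′₂(U)A⟩₁` (co-curl adjoint to curl, n06-j C7). [cite: Balaban1985BackgroundPropagators, (3.10) p.392, (3.9) p.392] -/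
theorem trIP_hessY_eq (hU : ∀ μ x, ((U μ x : (Matrix (Fin N) (Fin N) ℂ)ˣ) : Matrix (Fin N) (Fin N) ℂ) ∈ unitary (Matrix (Fin N) (Fin N) ℂ))
    (A : FBondY i → Matrix (Fin N) (Fin N) ℂ) :
    trIP (fun _ => (1 : ℝ)) A (hessY i U A) =
      trIP (fun _ => (1 : ℝ)) (curlY i U A) (jordanY i U (curlY i U A)) + trIP (fun _ => (1 : ℝ)) A (curv2Y i U A) := by
  rw [hessY, LinearMap.add_apply, trIP_add_right, LinearMap.comp_apply, LinearMap.comp_apply, ← isAdjTr_curlY_coCurlY i U hU]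

/-- ★★★ **«Δ′ IS A SMALL PERTURBATION OF D\*D» AT def-Y's LETTERS, local form**: at every unitary-valued background
`⟨A, Δ(U)A⟩₁ ≥ Σ_p (1 − |Re U(∂p) − 1|)·HS((D_UA)(p)) − 3·c_f²·Σ_p |Im U(∂p)|·Σ_{m<4} HS(A(b_m(p)))`.
[cite: Balaban1985BackgroundPropagators, p.392 (after (3.10)), (3.69) p.404] -/
theorem trIP_hessY_ge (hU : ∀ μ x, ((U μ x : (Matrix (Fin N) (Fin N) ℂ)ˣ) : Matrix (Fin N) (Fin N) ℂ) ∈ unitary (Matrix (Fin N) (Fin N) ℂ))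
    (A : FBondY i → Matrix (Fin N) (Fin N) ℂ) :
    ∑ p : PlaqY i, (1 - ‖reHolY i U p - 1‖) * ∑ a, ∑ b, ‖curlY i U A p a b‖ ^ 2
      - 3 * ∑ p : PlaqY i, i.cf ^ 2 * ‖imHolY i U p‖ * ∑ m : Fin 4, ∑ a, ∑ b, ‖A (edgeY i p m) a b‖ ^ 2
      ≤ trIP (fun _ => (1 : ℝ)) A (hessY i U A) := by
  rw [trIP_hessY_eq i hU A]
  have h1 := trIP_jordanY_ge i U (curlY i U A)
  have h2 := abs_trIP_curv2Y_le i U hU A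
  simp_rw [norm_weight_eq] at h2
  rw [abs_le] at h2
  linarith [h2.1]

/-- ★★★ **«Δ′ IS A SMALL PERTURBATION OF D\*D», uniform form**: if every plaquette holonomy is `δ`-close to `1`, then
`⟨A, Δ(U)A⟩₁ ≥ (1 − δ)·⟨D_UA, D_UA⟩₁ − 12(d+1)·c_f²·δ·⟨A, A⟩₁` (print's (3.35) makes `c_f²δ = O(1)·Mα₀·(Lʲη)⁻²·η²c_f² …`, i.e. the (3.69) constant).
[cite: Balaban1985BackgroundPropagators, (3.69) p.404, p.392 (after (3.10))] -/
theorem trIP_hessY_ge_of_plaquette_small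
    (hU : ∀ μ x, ((U μ x : (Matrix (Fin N) (Fin N) ℂ)ˣ) : Matrix (Fin N) (Fin N) ℂ) ∈ unitary (Matrix (Fin N) (Fin N) ℂ)) {δ : ℝ} (hδ0 : 0 ≤ δ)
    (hδ : ∀ p : PlaqY i, ‖((holY i U p : (Matrix (Fin N) (Fin N) ℂ)ˣ) : Matrix (Fin N) (Fin N) ℂ) - 1‖ ≤ δ)
    (A : FBondY i → Matrix (Fin N) (Fin N) ℂ) :
    (1 - δ) * trIP (fun _ => (1 : ℝ)) (curlY i U A) (curlY i U A) - 12 * (d + 1) * i.cf ^ 2 * δ * trIP (fun _ => (1 : ℝ)) A A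
      ≤ trIP (fun _ => (1 : ℝ)) A (hessY i U A) := by
  have h0 := trIP_hessY_ge i hU A
  -- the Jordan part: `(1 − δ)·Σ_p HS((D_UA)(p)) ≤ Σ_p (1 − |Re U(∂p) − 1|)·HS((D_UA)(p))`
  have hJ : (1 - δ) * trIP (fun _ => (1 : ℝ)) (curlY i U A) (curlY i U A) ≤
      ∑ p : PlaqY i, (1 - ‖reHolY i U p - 1‖) * ∑ a, ∑ b, ‖curlY i U A p a b‖ ^ 2 := by
    rw [trIP_one_self_eq, Finset.mul_sum]
    exact Finset.sum_le_sum fun p _ => mul_le_mul_of_nonneg_right (by linarith [norm_reHolY_sub_one_le i U hU (hδ p)]) (hs_nonneg _)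
  -- the commutator part: `Σ_p c_f²|Im U(∂p)|·Σ_m HS(A(b_m(p))) ≤ c_f²δ·Σ_p Σ_m HS(A(b_m(p))) ≤ c_f²δ·4(d+1)·⟨A, A⟩₁`
  have hC : ∑ p : PlaqY i, i.cf ^ 2 * ‖imHolY i U p‖ * ∑ m : Fin 4, ∑ a, ∑ b, ‖A (edgeY i p m) a b‖ ^ 2 ≤
      ∑ p : PlaqY i, (i.cf ^ 2 * δ) * ∑ m : Fin 4, ∑ a, ∑ b, ‖A (edgeY i p m) a b‖ ^ 2 :=
    Finset.sum_le_sum fun p _ => mul_le_mul_of_nonneg_right (mul_le_mul_of_nonneg_left (norm_imHolY_le i U hU (hδ p)) (sq_nonneg _))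
      (Finset.sum_nonneg fun _ _ => hs_nonneg _)
  rw [← Finset.mul_sum] at hC
  have hE := sum_edgeY_le i (g := fun b => ∑ a, ∑ b', ‖A b a b'‖ ^ 2) fun _ => hs_nonneg _
  rw [← trIP_one_self_eq] at hE
  have hE' := mul_le_mul_of_nonneg_left hE (by positivity : (0 : ℝ) ≤ i.cf ^ 2 * δ)
  linarith [h0, hJ, hC, hE']

/-- ★★★ **ROW 17's ONE DISPLAYED CLAUSE REDUCED TO THE PRINCIPAL PART**: at a `G`-valued background (`G ≤ U(N)`) whose plaquette holonomies are `δ`-close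
to `1`, if the PRINCIPAL gauge-fixed form of (3.26) is coercive — `γ⟨A, A⟩₁ ≤ (1−δ)⟨D_UA, D_UA⟩₁ + ⟨D\*_UA, R(U)D\*_UA⟩₁ + ⟨Q(U)A, Q(U)A⟩_w` — with
`γ > 12(d+1)c_f²δ`, then def-Y's `Δ_a(U)` (letters `parSymY ∕ parBY ∕ GpY`) is positive definite: `PosDefTr 1 (deltaAY …)`, the clause `hΔA` of n06-d's
certificate at this `U`.  The coercivity (Thm 3.3 ∕ [4]) and `(3.35) ⇒ δ-small plaquettes` stay DISPLAYED. [cite: Balaban1985BackgroundPropagators, Thm 3.11 p.416, (3.26) p.395, (3.69) p.404] -/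
theorem posDefTr_deltaAY_parSymY_of_principal {G : Subgroup (Matrix (Fin N) (Fin N) ℂ)ˣ}
    (hG : G ≤ B7Prop2Explicit.unitaryUnits (Matrix (Fin N) (Fin N) ℂ)) (hU : ∀ μ x, U μ x ∈ G) {δ γ : ℝ} (hδ0 : 0 ≤ δ)
    (hδ : ∀ p : PlaqY i, ‖((holY i U p : (Matrix (Fin N) (Fin N) ℂ)ˣ) : Matrix (Fin N) (Fin N) ℂ) - 1‖ ≤ δ)
    (hcoer : ∀ A : FBondY i → Matrix (Fin N) (Fin N) ℂ,
      γ * trIP (fun _ => (1 : ℝ)) A A ≤ (1 - δ) * trIP (fun _ => (1 : ℝ)) (curlY i U A) (curlY i U A)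
        + trIP (fun _ => (1 : ℝ)) (divY i U A) (RY i (parSymY i) (GpY i (parSymY i)) U (divY i U A))
        + trIP i.w (QY i (parBY i) U A) (QY i (parBY i) U A))
    (hγ : 12 * (d + 1) * i.cf ^ 2 * δ < γ) :
    PosDefTr (fun _ => (1 : ℝ)) (deltaAY i (parSymY i) (parBY i) (GpY i (parSymY i)) U) := by
  have hU' : ∀ μ x, ((U μ x : (Matrix (Fin N) (Fin N) ℂ)ˣ) : Matrix (Fin N) (Fin N) ℂ) ∈ unitary (Matrix (Fin N) (Fin N) ℂ) := fun μ x => hG (hU μ x)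
  refine posDefTr_deltaAY_parSymY_of_forms i hG hU fun A hA => ?_
  have h1 := trIP_hessY_ge_of_plaquette_small i hU' hδ0 hδ A
  have h2 := hcoer A
  have hpos : 0 < (γ - 12 * (d + 1) * i.cf ^ 2 * δ) * trIP (fun _ => (1 : ℝ)) A A :=
    mul_pos (by linarith) (trIP_self_pos _ (fun _ => one_pos) hA)
  nlinarith [h1, h2, hpos]

end Hessian

end Literature.MathematicalPhysics.QuantumFieldTheory.Balaban1983to89.B9Thm311PosOfPrincipalAtLettersY
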